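import Literature.AnabelianGeometry.SemiGraphs.SubdivisionLemmas
import HarnessLib

/-!
# In a tree, three distinct vertices are never pairwise adjacent ([SemiAnbd] §1 p. 13; Thm. 3.7 (iii) p. 41)

Mochizuki, *Semi-graphs of anabelioids*, Publ. RIMS **42** (2006), §1 p. 13 (a *tree*: the associated
topological space is contractible — the tree's `SemiGraph.IsTree`, i.e. the barycentric subdivision is a
connected acyclic simple graph) and the "only two" step of the proof of Theorem 3.7 (iii), p. 41 ("if `H`
is contained in three distinct verticial subgroups, then … one obtains a contradiction"): at a level of
the tower of universal coverings where three compatible systems of `H`-fixed vertices are pairwise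
distinct, pairwise adjacency would give a TRIANGLE in a tree. [cite: MochizukiSemiAnbd2006, Thm. 3.7(iii) p.41]

PROOF-ONLY toolkit lemma (cell abc-iut, layer L3, GAP row G-t6g3-2 «Thm 3.7 (iii)/Cor 3.9 beyond finite
𝒢», lemma T0 of abc-iut-L3-t10's SHAPES memo `SHAPES-Ggt6g32.md` §(c); seat abc-iut-w5-d160; no
definition).  Elementary: the length-`4` path `x – b – e₃ – b′ – z` and the length-`8` path
`x – ⋯ – e₁ – ⋯ – y – ⋯ – e₂ – ⋯ – z` of the subdivision are two paths between the same nodes of an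
acyclic simple graph, hence equal (`SimpleGraph.IsAcyclic.path_unique`) — absurd.  Pattern of
`SemiGraph.edge_unique_of_abuts` (`TreeSystemFixedPair.lean`, abc-iut-L3-t11).

* `SemiGraph.Joins.eq_or_eq_of_abuts` — an edge joining `u` and `v` abuts only to `u` and `v`;
* `SemiGraph.IsTree.no_triangle` — three pairwise distinct vertices of a tree are not pairwise joined by edges;
* `SemiGraph.IsTree.no_triangle_of_abuts` — the same with the six branches explicit (the shape in which
  level-wise adjacency of fixed systems is produced).
-/

namespace Literature.AnabelianGeometry.SemiGraphs

namespace SemiGraph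

universe u

variable {G : SemiGraph.{u}}

/-- An edge joining `u` and `v` abuts to no third vertex: every branch of it that abuts to a vertex `w`
has `w = u` or `w = v` (an edge has exactly two branches). [cite: MochizukiSemiAnbd2006, §1 p.11] -/
theorem Joins.eq_or_eq_of_abuts {e : G.Edge} {u v : G.Vertex} (h : G.Joins e u v) {b : G.Branch}
    (hbe : G.edgeOf b = e) {w : G.Vertex} (hbw : G.abuts b = some w) : w = u ∨ w = v := by
  obtain ⟨b₁, b₂, hne, h₁e, h₂e, h₁u, h₂v⟩ := h
  obtain ⟨c₁, c₂, -, -, -, hall⟩ := G.two_branches e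
  -- `b₁`, `b₂` are the two branches of `e`, so `b` is one of them
  have hb : b = b₁ ∨ b = b₂ := by
    rcases hall b hbe with rfl | rfl
    · rcases hall b₁ h₁e with h | h
      · exact Or.inl h.symm
      · rcases hall b₂ h₂e with h' | h'
        · exact Or.inr h'.symm
        · exact absurd (h.trans h'.symm) hne
    · rcases hall b₁ h₁e with h | h
      · rcases hall b₂ h₂e with h' | h'
        · exact absurd (h.trans h'.symm) hne
        · exact Or.inr h'.symm
      · exact Or.inl h.symm
  rcases hb with rfl | rfl
  · rw [h₁u] at hbw
    exact Or.inl (Option.some_injective _ hbw).symm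
  · rw [h₂v] at hbw
    exact Or.inr (Option.some_injective _ hbw).symm

/-- A morphism-free form of `Joins`: two distinct branches of one edge at the vertices `u ≠ v` make the
edge join `u` and `v`. [cite: MochizukiSemiAnbd2006, §1 p.11] -/
theorem joins_of_abuts {e : G.Edge} {u v : G.Vertex} (huv : u ≠ v) {b b' : G.Branch}
    (hbe : G.edgeOf b = e) (hb'e : G.edgeOf b' = e) (hbu : G.abuts b = some u)
    (hb'v : G.abuts b' = some v) : G.Joins e u v := by
  refine ⟨b, b', ?_, hbe, hb'e, hbu, hb'v⟩
  rintro rfl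
  rw [hbu] at hb'v
  exact huv (Option.some_injective _ hb'v)

/-- **No triangles in a tree.**  Three pairwise distinct vertices `x`, `y`, `z` of a tree are not
pairwise joined by edges: the paths `x – e₃ – z` (length `4`) and `x – e₁ – y – e₂ – z` (length `8`) of
the barycentric subdivision would be two distinct paths with the same end-points in an acyclic graph.
(The "only two verticial subgroups" step of [SemiAnbd] Thm. 3.7 (iii) at a fixed level.)
[cite: MochizukiSemiAnbd2006, Thm. 3.7(iii) p.41] -/
theorem IsTree.no_triangle (hG : G.IsTree) {x y z : G.Vertex} (hxy : x ≠ y) (hyz : y ≠ z)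
    (hxz : x ≠ z) {e₁ e₂ e₃ : G.Edge} (h₁ : G.Joins e₁ x y) (h₂ : G.Joins e₂ y z)
    (h₃ : G.Joins e₃ x z) : False := by
  have hA : G.subdivision.IsAcyclic := hG.isTree.isAcyclic
  -- `e₁ ≠ e₂`: `e₁` abuts only to `x`, `y`, while `e₂` has a branch at `z`
  have h12 : e₁ ≠ e₂ := by
    rintro rfl
    obtain ⟨-, c', -, -, hc'e, -, hc'z⟩ := h₂
    rcases h₁.eq_or_eq_of_abuts hc'e hc'z with h | h
    · exact hxz h.symm
    · exact hyz h.symm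
  obtain ⟨b₁, b₁', hb₁, hb₁e, hb₁'e, hb₁x, hb₁'y⟩ := h₁
  obtain ⟨c₂, c₂', hc₂, hc₂e, hc₂'e, hc₂y, hc₂'z⟩ := h₂
  obtain ⟨d₃, d₃', hd₃, hd₃e, hd₃'e, hd₃x, hd₃'z⟩ := h₃
  -- branch inequalities along the long path
  have hb₁c₂ : b₁ ≠ c₂ := by
    rintro rfl; rw [hb₁x] at hc₂y; exact hxy (Option.some_injective _ hc₂y)
  have hb₁c₂' : b₁ ≠ c₂' := by
    rintro rfl; rw [hb₁x] at hc₂'z; exact hxz (Option.some_injective _ hc₂'z)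
  have hb₁'c₂ : b₁' ≠ c₂ := by
    rintro rfl; exact h12 (hb₁'e.symm.trans hc₂e)
  have hb₁'c₂' : b₁' ≠ c₂' := by
    rintro rfl; rw [hb₁'y] at hc₂'z; exact hyz (Option.some_injective _ hc₂'z)
  -- adjacency steps of the subdivision
  have adjVB : ∀ {v : G.Vertex} {b : G.Branch}, G.abuts b = some v →
      G.subdivision.Adj (Sum.inl v) (Sum.inr (Sum.inr b)) :=
    fun {v b} h => (G.subdivision_adj_inl_iff v _).mpr ⟨b, h, rfl⟩
  have adjBE : ∀ {b : G.Branch} {e : G.Edge}, G.edgeOf b = e →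
      G.subdivision.Adj (Sum.inr (Sum.inr b)) (Sum.inr (Sum.inl e)) :=
    fun {b e} h => (G.subdivision_adj_branch_iff b _).mpr (Or.inl (by rw [h]))
  have adjEB : ∀ {e : G.Edge} {b : G.Branch}, G.edgeOf b = e →
      G.subdivision.Adj (Sum.inr (Sum.inl e)) (Sum.inr (Sum.inr b)) :=
    fun {e b} h => (G.subdivision_adj_edge_iff e _).mpr ⟨b, h, rfl⟩
  have adjBV : ∀ {b : G.Branch} {v : G.Vertex}, G.abuts b = some v →
      G.subdivision.Adj (Sum.inr (Sum.inr b)) (Sum.inl v) :=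
    fun {b v} h => (G.subdivision_adj_branch_iff b _).mpr (Or.inr ⟨v, h, rfl⟩)
  -- the short path `x – d₃ – e₃ – d₃' – z`
  let p : G.subdivision.Walk (Sum.inl x) (Sum.inl z) :=
    SimpleGraph.Walk.cons (adjVB hd₃x) (SimpleGraph.Walk.cons (adjBE hd₃e)
      (SimpleGraph.Walk.cons (adjEB hd₃'e) (SimpleGraph.Walk.cons (adjBV hd₃'z) SimpleGraph.Walk.nil)))
  have hp : p.IsPath := by
    simp [p, SimpleGraph.Walk.isPath_def, hd₃, hxz]
  -- the long path `x – b₁ – e₁ – b₁' – y – c₂ – e₂ – c₂' – z`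
  let q : G.subdivision.Walk (Sum.inl x) (Sum.inl z) :=
    SimpleGraph.Walk.cons (adjVB hb₁x) (SimpleGraph.Walk.cons (adjBE hb₁e)
      (SimpleGraph.Walk.cons (adjEB hb₁'e) (SimpleGraph.Walk.cons (adjBV hb₁'y)
        (SimpleGraph.Walk.cons (adjVB hc₂y) (SimpleGraph.Walk.cons (adjBE hc₂e)
          (SimpleGraph.Walk.cons (adjEB hc₂'e) (SimpleGraph.Walk.cons (adjBV hc₂'z)
            SimpleGraph.Walk.nil)))))))
  have hq : q.IsPath := by
    simp [q, SimpleGraph.Walk.isPath_def, hxy, hyz, hxz, hb₁, hc₂, h12, hb₁c₂, hb₁c₂', hb₁'c₂,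
      hb₁'c₂']
  have h := congrArg (fun r : G.subdivision.Path _ _ => r.1.length) (hA.path_unique ⟨p, hp⟩ ⟨q, hq⟩)
  simp [p, q] at h

/-- **No triangles in a tree**, branch-level form: three pairwise distinct vertices `x`, `y`, `z` and
three edges with branches `b₁ ∈ e₁` at `x`, `b₁′ ∈ e₁` at `y`, `c₂ ∈ e₂` at `y`, `c₂′ ∈ e₂` at `z`,
`d₃ ∈ e₃` at `x`, `d₃′ ∈ e₃` at `z` cannot coexist in a tree (the shape produced by level-wise adjacency
of compatible fixed systems, [SemiAnbd] Thm. 3.7 (iii) p. 41). [cite: MochizukiSemiAnbd2006, Thm. 3.7(iii) p.41] -/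
theorem IsTree.no_triangle_of_abuts (hG : G.IsTree) {x y z : G.Vertex} (hxy : x ≠ y) (hyz : y ≠ z)
    (hxz : x ≠ z) {e₁ e₂ e₃ : G.Edge} {b₁ b₁' c₂ c₂' d₃ d₃' : G.Branch}
    (hb₁e : G.edgeOf b₁ = e₁) (hb₁'e : G.edgeOf b₁' = e₁) (hb₁x : G.abuts b₁ = some x)
    (hb₁'y : G.abuts b₁' = some y) (hc₂e : G.edgeOf c₂ = e₂) (hc₂'e : G.edgeOf c₂' = e₂)
    (hc₂y : G.abuts c₂ = some y) (hc₂'z : G.abuts c₂' = some z) (hd₃e : G.edgeOf d₃ = e₃)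
    (hd₃'e : G.edgeOf d₃' = e₃) (hd₃x : G.abuts d₃ = some x) (hd₃'z : G.abuts d₃' = some z) :
    False :=
  hG.no_triangle hxy hyz hxz (joins_of_abuts hxy hb₁e hb₁'e hb₁x hb₁'y)
    (joins_of_abuts hyz hc₂e hc₂'e hc₂y hc₂'z) (joins_of_abuts hxz hd₃e hd₃'e hd₃x hd₃'z)

end SemiGraph

end Literature.AnabelianGeometry.SemiGraphs
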